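/-
Copyright (c) 2026 the pub-hodgecm-mathlib formalisation cell (harness21).  Prover seat hodgecm-mathlib-K2E3-p04 (g2), Track B ∕ K2-LIT
(build stream 29), h413 = `stmt-HodgeConjecture-24833`, line `K2_E3_EllipticInputs`, unit U4 «Keys» — road I («Keys' own road»: the rank-one intertwining
integral), brick I-3h «THE UNRAMIFIED LINE IN THE ORGAN'S CURRENCY».  2026-09-04.
-/
import Summits.HodgeConjecture.HodgeConjecture.Theorems.K2E3SphericalCFunctionShellExpansion   -- ★ p855911 (this base, g2): `apply_eq_apply_uniformizer_zpow`, `unitModulusChar_uniformizer_lt_one`; brings ★ NonUnitaryCharacterDichotomy, ★ TorusRay, ★ TorusCompactPart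
import Summits.HodgeConjecture.HodgeConjecture.Theorems.F0P3cStCharTSTorusChartIso             -- ★ `torusChart_mem_cmLocalIntegralLevel_iff` (`ι(α, z) ∈ K_v ↔ α ∈ 𝒪_vˣ`); brings ★ TorusDefs (`torusChart`, `cmTorusCharPair_torusChart`)
import HarnessLib

/-!
# h413 ∕ Track B «K2-LIT», unit U4 «Keys», road I brick I-3h: THE UNRAMIFIED LINE OF `U(Φ₃)(L⁺_v)` IN THE ORGAN'S CURRENCY — from «`χ = (χ₁, χ₂)` trivial on `T ∩ K_v`» and
# «`|χ₁(ϖ)| < 1`» to the working hypotheses of road I (`χ₁ = 1` on `𝒪_vˣ`, `χ₂(−1) = 1`, `|χ₁| = ‖·‖^s` with `s > 0`)   [Keys1984 §1, §7; Rogawski1990 §12.2; Casselman1995 §6.4]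

Cell `pub/hodgecm-mathlib`, crux H413 = `stmt-HodgeConjecture-24833` (lane `--supports … --as helper`), route HCCMUnconditional; dealer K2E3-plan (23:02Z ∕ 23:40:43Z (d); HANDOFF §4
«p04 I-3e»).  THEOREMS ONLY (0 def ∕ 0 instance ∕ 0 notation ∕ 0 sorry); ★-only imports.  The road-I theorems (★ p855911 … ★ `K2E3SphericalCFunctionFactorization`, the Macdonald
assemblies) are stated with three WORKING hypotheses on the character: (H1) `χ₁ u = 1` for `u ∈ 𝒪_vˣ = (Π_w 𝒪_w)ˣ`; (H2) `χ₂(−1) = 1`; (H3) `‖χ₁(x)‖ = ‖x‖^s` for all `x`, some `s > 0`.  The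
ORGAN speaks of a `K_v`-spherical `i_G(χ)` — `χ = cmTorusCharPair χ₁ χ₂` trivial on `T ∩ K_v` (the hypothesis of ★ `exists_sphericalVector`) — and of a CONTRACTING non-unitary `χ₁`
(U4-f: `‖x‖ < 1 ⇒ |χ₁ x| < 1`).  This file derives (H1)(H2)(H3) from those, so that a consumer on the unramified line quotes road I with NO extra hypothesis.

THE MATHEMATICS.  `v` non-split, `T ≅ E_vˣ × E¹_v` through the chart `ι(α, z) = d(α, zσ(α)α⁻¹, σ(α)⁻¹)` (★ `torusChart`) with `χ(ι(α, z)) = χ₁(α) χ₂(z)` (★ `cmTorusCharPair_torusChart`) and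
`ι(α, z) ∈ K_v ⟺ α ∈ 𝒪_vˣ` (★ `torusChart_mem_cmLocalIntegralLevel_iff`).
* §1 **`apply_eq_one_of_mem_unitsIntegers_of_trivial`** — (H1): `ι(u, 1) ∈ K_v` for `u ∈ 𝒪_vˣ`, so `χ₁(u) = χ₁(u)χ₂(1) = χ(ι(u,1)) = 1`;
  **`apply_neg_one_eq_one_of_trivial`** — (H2): `ι(1, −1) ∈ K_v`, so `χ₂(−1) = χ(ι(1, −1)) = 1`.
* §2 **`exists_rpow_modulus_of_unramified_of_norm_uniformizer_lt_one`** — (H3): for `χ₁ = 1` on `𝒪_vˣ` and `0 < |χ₁(ϖ)| < 1` (`ϖ` a uniformiser unit): with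
  `s := log|χ₁(ϖ)| ∕ log‖ϖ‖ > 0` one has `|χ₁(x)| = ‖x‖^s` for every `x ∈ E_vˣ` (`x = ϖⁿu`, `χ₁(x) = χ₁(ϖ)ⁿ` ★ `apply_eq_apply_uniformizer_zpow`, `‖x‖ = ‖ϖ‖ⁿ`);
  `norm_apply_uniformizer_lt_one_of_contracting` — the contracting hypothesis of U4-f gives `|χ₁(ϖ)| < 1` (`‖ϖ‖ < 1` ★).
So on the unramified line «contracting» ⟺ «`Re s > 0`» literally, and the closed-form `c`-function theorems apply to every `K_v`-spherical contracting `i_G(χ)`.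

HONEST LABEL.  HC_CM is proved only modulo the 7 printed citations (2 remaining named inputs: hLiu418 = `stmt-HodgeConjecture-24832`, h413 = `stmt-HodgeConjecture-24833`) until
rung 0 closes; count-neutral (no socket is paid by this file).

## References
* [Keys1984] D. Keys, *Principal series representations of special unitary groups over local fields*, Compositio Math. 51 (1984), §1 p. 116 (`λ_s = λ|·|_E^s`), §7 p. 126.
* [Rogawski1990] J. D. Rogawski, *Automorphic Representations of Unitary Groups in Three Variables* (1990), §12.1 p. 171, §12.2 p. 173 (`M ≅ E* × E¹`, unramified characters).
* [Casselman1995] W. Casselman, *Introduction to the theory of admissible representations of `p`-adic reductive groups* (1995), §6.4.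
* [WeilBNT1967] A. Weil, *Basic Number Theory* (1967), Ch. I §4 (`K^× = ϖ^ℤ × 𝒪^×`, the module).
-/

set_option autoImplicit false
-- the mandated namespace repeats the single-problem summit's segment (`HodgeConjecture.HodgeConjecture`)
set_option linter.dupNamespace false

noncomputable section

open NumberField IsDedekindDomain MeasureTheory
open scoped Matrix NNReal ENNReal

open Literature.NumberTheory Literature.NumberTheory.Automorphic Literature.NumberTheory.Automorphic.UnitaryGroup
open Literature.NumberTheory.GaloisRepresentations Literature.NumberTheory.GaloisRepresentations.IsNonarchimedeanLocalField

namespace Summit.HodgeConjecture.HodgeConjecture.Cruxes.H413.K2E3SphericalCFunctionUnramifiedHypotheses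

variable (L : Type) [Field L] [NumberField L] [IsCMField L] (v : HeightOneSpectrum (𝓞 ↥(maximalRealSubfield L)))
  (hns : ∀ w : PlacesOver L v, IsCMField.complexConj L • w.1 = w.1)

/-! ## §1 (H1) and (H2) from «`χ` trivial on `T ∩ K_v`» -/

set_option synthInstance.maxHeartbeats 400000 in
set_option maxHeartbeats 3200000 in
-- the torus chart on the matrix carrier (class of ★ `F0P3cStCharTSTorusChartIso.torusChart_mem_cmLocalIntegralLevel_iff`)
include hns in
/-- **(H1): an unramified `χ = (χ₁, χ₂)` has `χ₁ = 1` on `𝒪_vˣ`.**  If `χ(t) = 1` for every `t ∈ T ∩ K_v` then for `u ∈ 𝒪_vˣ = (Π_w 𝒪_w)ˣ`: `ι(u, 1) ∈ K_v` (★ `torusChart_mem_cmLocalIntegralLevel_iff`) and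
`χ(ι(u, 1)) = χ₁(u)·χ₂(1)` (★ `cmTorusCharPair_torusChart`). `v` non-split. [cite: Rogawski1990, §12.2 p. 173] [cite: Keys1984, §7 p. 126] -/
theorem apply_eq_one_of_mem_unitsIntegers_of_trivial (χ₁ : (LocalRing L v)ˣ →* ℂˣ) (χ₂ : ↥(normOneUnits (conjLocal L (IsCMField.complexConj L) v)) →* ℂˣ)
    (hχK : ∀ t : ↥(torusU (conjLocal L (IsCMField.complexConj L) v) (cmLocalForm L 3 v)), (t : ↥(unitaryGroupOfForm (conjLocal L (IsCMField.complexConj L) v) (cmLocalForm L 3 v))) ∈ cmLocalIntegralLevel L 3 (Matrix.of fun i j : Fin 3 => if i.val + j.val + 1 = 3 then (1 : L) else 0) v → cmTorusCharPair L v χ₁ χ₂ t = 1)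
    (u : (LocalRing L v)ˣ) (hu : u ∈ (Submonoid.pi Set.univ (fun w : PlacesOver L v => (w.1.adicCompletionIntegers L).toSubring.toSubmonoid)).units) : χ₁ u = 1 := by
  have hK : ((F0P3cStCharTSTorusDefs.torusChart L v (u, 1) : ↥(cmBorelTriple L 3 v).M) : ↥(unitaryGroupOfForm (conjLocal L (IsCMField.complexConj L) v) (cmLocalForm L 3 v))) ∈ cmLocalIntegralLevel L 3 (Matrix.of fun i j : Fin 3 => if i.val + j.val + 1 = 3 then (1 : L) else 0) v :=
    (F0P3cStCharTSTorusChartIso.torusChart_mem_cmLocalIntegralLevel_iff L v hns (u, 1)).2 (Subgroup.mem_prod.2 ⟨hu, Subgroup.mem_top _⟩)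
  have h := hχK _ hK
  rwa [F0P3cStCharTSTorusDefs.cmTorusCharPair_torusChart, map_one, mul_one] at h

set_option synthInstance.maxHeartbeats 400000 in
set_option maxHeartbeats 3200000 in
-- the torus chart on the matrix carrier (class of ★ `F0P3cStCharTSTorusChartIso.torusChart_mem_cmLocalIntegralLevel_iff`)
include hns in
/-- **(H2): an unramified `χ = (χ₁, χ₂)` has `χ₂(−1) = 1`** (`ι(1, −1) = d(1, −1, 1) ∈ K_v`). `v` non-split. [cite: Rogawski1990, §12.1 p. 171; §12.2 p. 173] -/
theorem apply_neg_one_eq_one_of_trivial (χ₁ : (LocalRing L v)ˣ →* ℂˣ) (χ₂ : ↥(normOneUnits (conjLocal L (IsCMField.complexConj L) v)) →* ℂˣ)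
    (hχK : ∀ t : ↥(torusU (conjLocal L (IsCMField.complexConj L) v) (cmLocalForm L 3 v)), (t : ↥(unitaryGroupOfForm (conjLocal L (IsCMField.complexConj L) v) (cmLocalForm L 3 v))) ∈ cmLocalIntegralLevel L 3 (Matrix.of fun i j : Fin 3 => if i.val + j.val + 1 = 3 then (1 : L) else 0) v → cmTorusCharPair L v χ₁ χ₂ t = 1) :
    χ₂ ⟨-1, F0P3cStCharTSBigCellFactorisation.neg_one_mem_normOneUnits (conjLocal L (IsCMField.complexConj L) v)⟩ = 1 := by
  have h1 : (1 : (LocalRing L v)ˣ) ∈ (Submonoid.pi Set.univ (fun w : PlacesOver L v => (w.1.adicCompletionIntegers L).toSubring.toSubmonoid)).units := Subgroup.one_mem _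
  have hK : ((F0P3cStCharTSTorusDefs.torusChart L v (1, ⟨-1, F0P3cStCharTSBigCellFactorisation.neg_one_mem_normOneUnits (conjLocal L (IsCMField.complexConj L) v)⟩) : ↥(cmBorelTriple L 3 v).M) : ↥(unitaryGroupOfForm (conjLocal L (IsCMField.complexConj L) v) (cmLocalForm L 3 v))) ∈ cmLocalIntegralLevel L 3 (Matrix.of fun i j : Fin 3 => if i.val + j.val + 1 = 3 then (1 : L) else 0) v :=
    (F0P3cStCharTSTorusChartIso.torusChart_mem_cmLocalIntegralLevel_iff L v hns _).2 (Subgroup.mem_prod.2 ⟨h1, Subgroup.mem_top _⟩)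
  have h := hχK _ hK
  rwa [F0P3cStCharTSTorusDefs.cmTorusCharPair_torusChart, map_one, one_mul] at h

/-! ## §2 (H3): `|χ₁| = ‖·‖^s`, `s > 0`, for an unramified `χ₁` with `|χ₁(ϖ)| < 1` -/

include hns in
/-- **(H3): `|χ₁(x)| = ‖x‖^s` with `s = log|χ₁(ϖ)| ∕ log‖ϖ‖ > 0`**, for `χ₁ = 1` on `𝒪_vˣ` and `|χ₁(ϖ)| < 1` (`ϖ` a uniformiser unit, `v` non-split): every `x ∈ E_vˣ` is `ϖⁿu` with `u ∈ 𝒪_vˣ`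
(★ `exists_uniformizer_zpow_mul`), `χ₁(x) = χ₁(ϖ)ⁿ` (★ `apply_eq_apply_uniformizer_zpow`), `‖x‖ = ‖ϖ‖ⁿ` (`‖u‖ = 1` ★), and `‖ϖ‖^s = |χ₁(ϖ)|` by the choice of `s` (`0 < ‖ϖ‖ < 1` ★).
(Keys' parametrisation `λ_s = λ|·|_E^s` with `λ` unramified unitary, `Re s > 0`.) [cite: Keys1984, §1 p. 116; §7 p. 126] [cite: WeilBNT1967, Ch. I §4] -/
theorem exists_rpow_modulus_of_unramified_of_norm_uniformizer_lt_one (χ₁ : (LocalRing L v)ˣ →* ℂˣ)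
    (hunr : ∀ u ∈ (Submonoid.pi Set.univ (fun w : PlacesOver L v => (w.1.adicCompletionIntegers L).toSubring.toSubmonoid)).units, χ₁ u = 1)
    (ϖ : (LocalRing L v)ˣ) (hϖ : ∀ w : PlacesOver L v, Valued.v ((ϖ : LocalRing L v) w) = WithZero.exp (-1 : ℤ)) (hz : ‖((χ₁ ϖ : ℂˣ) : ℂ)‖ < 1) :
    ∃ s : ℝ, 0 < s ∧ ∀ x : (LocalRing L v)ˣ, ‖((χ₁ x : ℂˣ) : ℂ)‖ = ((unitModulusChar (LocalRing L v) x : ℝ≥0) : ℝ) ^ s := by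
  have ha0 : 0 < ((unitModulusChar (LocalRing L v) ϖ : ℝ≥0) : ℝ) := NNReal.coe_pos.2 distribHaarChar_pos
  have ha1 : ((unitModulusChar (LocalRing L v) ϖ : ℝ≥0) : ℝ) < 1 := by
    exact_mod_cast K2E3SphericalCFunctionShellExpansion.unitModulusChar_uniformizer_lt_one L v hns ϖ hϖ
  have hz0 : 0 < ‖((χ₁ ϖ : ℂˣ) : ℂ)‖ := norm_pos_iff.2 (Units.ne_zero _)
  have hla : Real.log ((unitModulusChar (LocalRing L v) ϖ : ℝ≥0) : ℝ) < 0 := Real.log_neg ha0 ha1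
  have hlz : Real.log ‖((χ₁ ϖ : ℂˣ) : ℂ)‖ < 0 := Real.log_neg hz0 hz
  refine ⟨Real.log ‖((χ₁ ϖ : ℂˣ) : ℂ)‖ / Real.log ((unitModulusChar (LocalRing L v) ϖ : ℝ≥0) : ℝ), div_pos_of_neg_of_neg hlz hla, fun x => ?_⟩
  -- `‖ϖ‖^s = |χ₁(ϖ)|`
  have hs : ((unitModulusChar (LocalRing L v) ϖ : ℝ≥0) : ℝ) ^ (Real.log ‖((χ₁ ϖ : ℂˣ) : ℂ)‖ / Real.log ((unitModulusChar (LocalRing L v) ϖ : ℝ≥0) : ℝ)) =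
      ‖((χ₁ ϖ : ℂˣ) : ℂ)‖ := by
    rw [Real.rpow_def_of_pos ha0, mul_div_cancel₀ _ hla.ne, Real.exp_log hz0]
  -- `x = ϖⁿ u`
  obtain ⟨n, u, hu, hx, hvx⟩ := K2E3NonUnitaryCharacterDichotomy.exists_uniformizer_zpow_mul L v hns ϖ hϖ x
  have hχx : χ₁ x = χ₁ ϖ ^ n := K2E3SphericalCFunctionShellExpansion.apply_eq_apply_uniformizer_zpow L v χ₁ hunr ϖ hϖ x n hvx
  have hmx : unitModulusChar (LocalRing L v) x = unitModulusChar (LocalRing L v) ϖ ^ n := by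
    rw [hx, map_mul, map_zpow, unitModulusChar_eq_one_of_forall_v_eq_one L v u ((F0P3cStCharTSTorusCompactPart.mem_unitsIntegers_iff L v u).1 hu), mul_one]
  rw [hχx, hmx, Units.val_zpow_eq_zpow_val, norm_zpow, NNReal.coe_zpow, ← Real.rpow_intCast, ← Real.rpow_intCast, ← Real.rpow_mul ha0.le, mul_comm,
    Real.rpow_mul ha0.le, hs]

include hns in
/-- **A CONTRACTING `χ₁` has `|χ₁(ϖ)| < 1`** for every uniformiser unit `ϖ` (`‖ϖ‖ < 1` ★ `unitModulusChar_uniformizer_lt_one`) — the U4-f hypothesis «`‖x‖ < 1 ⇒ |χ₁ x| < 1`» read at `ϖ`.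
[cite: Keys1984, §7 p. 126] -/
theorem norm_apply_uniformizer_lt_one_of_contracting (χ₁ : (LocalRing L v)ˣ →* ℂˣ)
    (hcontr : ∀ x : (LocalRing L v)ˣ, unitModulusChar (LocalRing L v) x < 1 → ‖((χ₁ x : ℂˣ) : ℂ)‖ < 1)
    (ϖ : (LocalRing L v)ˣ) (hϖ : ∀ w : PlacesOver L v, Valued.v ((ϖ : LocalRing L v) w) = WithZero.exp (-1 : ℤ)) : ‖((χ₁ ϖ : ℂˣ) : ℂ)‖ < 1 :=
  hcontr ϖ (K2E3SphericalCFunctionShellExpansion.unitModulusChar_uniformizer_lt_one L v hns ϖ hϖ)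

include hns in
/-- **(H3) from the U4-f hypotheses on the unramified line**: `χ₁ = 1` on `𝒪_vˣ` and contracting ⇒ `∃ s > 0, |χ₁| = ‖·‖^s` (§2 at any uniformiser unit ★ `exists_uniformizer_units`).
[cite: Keys1984, §1 p. 116; §7 p. 126] [cite: WeilBNT1967, Ch. I §4] -/
theorem exists_rpow_modulus_of_unramified_of_contracting (χ₁ : (LocalRing L v)ˣ →* ℂˣ)
    (hunr : ∀ u ∈ (Submonoid.pi Set.univ (fun w : PlacesOver L v => (w.1.adicCompletionIntegers L).toSubring.toSubmonoid)).units, χ₁ u = 1)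
    (hcontr : ∀ x : (LocalRing L v)ˣ, unitModulusChar (LocalRing L v) x < 1 → ‖((χ₁ x : ℂˣ) : ℂ)‖ < 1) :
    ∃ s : ℝ, 0 < s ∧ ∀ x : (LocalRing L v)ˣ, ‖((χ₁ x : ℂˣ) : ℂ)‖ = ((unitModulusChar (LocalRing L v) x : ℝ≥0) : ℝ) ^ s := by
  obtain ⟨ϖ, hϖ⟩ := F0P3cStCharTSTorusRay.exists_uniformizer_units L v
  exact exists_rpow_modulus_of_unramified_of_norm_uniformizer_lt_one L v hns χ₁ hunr ϖ hϖ (norm_apply_uniformizer_lt_one_of_contracting L v hns χ₁ hcontr ϖ hϖ)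

end Summit.HodgeConjecture.HodgeConjecture.Cruxes.H413.K2E3SphericalCFunctionUnramifiedHypotheses

end
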